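import Literature.AnabelianGeometry.EtaleTheta.RigidOfSetting
import Literature.AnabelianGeometry.EtaleTheta.SettingModelKummerDataEmpty
import HarnessLib

/-!
# [EtTh] Cor. 2.9 p. 43: the labelled-cusps record `CuspLabels` — NON-VACUITY census
# (abc-iut cell, NV-L2 map (C), row #9-R74; proof-only)

Mochizuki, *The étale theta function …*, Publ. RIMS **45** (2009) [EtTh], §2, Cor. 2.9 p. 43 ("labels
`∈ ℤ` for the cusps of `Y`", "labels for the cusps … may be thought of as well-defined elements of
`(ℤ/lℤ)^±`") [cite: MochizukiEtTh2009, Cor 2.9 p.43].  PROOF-ONLY census file (abc-iut cell, prover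
abc-iut-L2-d1 gen 4, L2-lead row #9-R74 «NV-L2/ThetaSetting.EtaleThetaData +
EtaleThetaData.DoubleUnderline.CuspLabels at `ThetaSetting.model p`»); no definition, no named fact.

FINDINGS (kernel-certified below).
* `EtaleThetaData.DoubleUnderline.CuspLabels C` (abc-iut-L2-t8, `RigidOfSetting.lean`) is INHABITABLE ON
  ITS OWN wherever its parameters `(D, E, l, C)` exist, with ZERO hypotheses: the record is exactly the
  product `{cuspY : ℤ → Set _} × {cuspX : ZMod l → Set _ // cuspX (−a) = cuspX a}` — its only law is
  the `(ℤ/lℤ)^±`-evenness of `cuspX`, and EVERY such pair of families is a `CuspLabels`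
  (`exists_cuspLabels_eq`, `nonempty_cuspLabels`, `exists_cuspLabels_symm`).  So its non-vacuity carries
  NO information: the dictionary "label ↔ irreducible component of the special fibre ↔ cuspidal
  decomposition group" of Cor. 2.9 is not in the record (the §1 typing has no cusp carrier —
  `RigidOfSetting.lean` header, TODO-merge(abc-iut-L2-t1/abc-iut-L3-t2)); inhabited ≠ endorsed.
* AT THE ROOT MODEL `ThetaSetting.model p` the parameter type is EMPTY: there is no
  `E : (model p).EtaleThetaData` (abc-iut-w5-d171's `ThetaSetting.model_isEmpty_etaleThetaData`, p424679:
  `KummerData` needs a non-trivial cyclotomic action on `Δ_Θ`), hence no `C : E.DoubleUnderline l` and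
  no `CuspLabels` instance to inhabit — every statement about cusp labels at the root model holds
  vacuously (`isEmpty_sigma_doubleUnderline_model`, `forall_cuspLabels_model`).  The `EtaleThetaData`
  half of the row is w5-d171's theorem, cited BY NAME, not re-proved.
HONEST FRAMING: nothing of [EtTh] is asserted; no side is taken on [IUTchIII] Cor. 3.12.
-/

namespace Literature.AnabelianGeometry.EtaleTheta

namespace ThetaSetting

variable {p : ℕ} [Fact p.Prime] {D : ThetaSetting p} {E : D.EtaleThetaData} {l : ℕ}

namespace EtaleThetaData.DoubleUnderline

open Literature.AnabelianGeometry.SemiGraphs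

/-! ### `CuspLabels` is the free product of an arbitrary `ℤ`-family and an even `ZMod l`-family -/

/-- **Every pair (any `ℤ`-family of sets of subgroups of `Π^tp_{Y̲̲}`, any EVEN `(ℤ/lℤ)`-family of sets of
subgroups of `Π^tp_{X̲̲}`) IS a `CuspLabels` record** with exactly these fields — the record imposes no
law beyond `cuspX (−a) = cuspX a` ("well-defined elements of `(ℤ/lℤ)^±`", p. 43).
[cite: MochizukiEtTh2009, Cor 2.9 p.43] -/
theorem exists_cuspLabels_eq (C : E.DoubleUnderline l)
    (SY : ℤ → Set (Subgroup (D.GtpY.subgroupOf C.Huu))) (SX : ZMod l → Set (Subgroup C.Huu))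
    (hSX : ∀ a, SX (-a) = SX a) :
    ∃ L : C.CuspLabels, L.cuspY = SY ∧ L.cuspX = SX :=
  ⟨⟨SY, SX, hSX⟩, rfl, rfl⟩

/-- **`CuspLabels` is inhabited at every `(D, E, l, C)`, with zero hypotheses** (e.g. by the empty
families) — NV-L2 census: "inhabitable on its own; inhabited ≠ endorsed".
[cite: MochizukiEtTh2009, Cor 2.9 p.43] -/
theorem nonempty_cuspLabels (C : E.DoubleUnderline l) : Nonempty C.CuspLabels :=
  ⟨⟨fun _ => ∅, fun _ => ∅, fun _ => rfl⟩⟩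

/-- **Symmetrisation**: ANY `(ℤ/lℤ)`-family `SX` of sets of subgroups of `Π^tp_{X̲̲}` (e.g. "the cuspidal
decomposition groups of the cusp labelled `a`", were such a carrier typed) yields a `CuspLabels` record
with `cuspX a = SX a ∪ SX (−a)` — the passage to `(ℤ/lℤ)^± = (ℤ/lℤ)/{±1}` (p. 43) — and any prescribed
`cuspY`. [cite: MochizukiEtTh2009, Cor 2.9 p.43] -/
theorem exists_cuspLabels_symm (C : E.DoubleUnderline l)
    (SY : ℤ → Set (Subgroup (D.GtpY.subgroupOf C.Huu))) (SX : ZMod l → Set (Subgroup C.Huu)) :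
    ∃ L : C.CuspLabels, L.cuspY = SY ∧ ∀ a, L.cuspX a = SX a ∪ SX (-a) :=
  ⟨⟨SY, fun a => SX a ∪ SX (-a), fun a => by rw [neg_neg, Set.union_comm]⟩, rfl, fun _ => rfl⟩

/-- **The record does not determine its fields**: two `CuspLabels` over the same `C` may differ (as soon
as `Π^tp_{X̲̲}` has a subgroup, e.g. `⊥`) — the labels↔cusps dictionary of Cor. 2.9 is INPUT, not a
consequence of the typing. [cite: MochizukiEtTh2009, Cor 2.9 p.43] -/
theorem exists_cuspLabels_ne (C : E.DoubleUnderline l) : ∃ L L' : C.CuspLabels, L ≠ L' := by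
  refine ⟨⟨fun _ => ∅, fun _ => ∅, fun _ => rfl⟩, ⟨fun _ => {⊥}, fun _ => ∅, fun _ => rfl⟩, fun h => ?_⟩
  have h1 : (∅ : Set (Subgroup (D.GtpY.subgroupOf C.Huu))) = {⊥} :=
    congrFun (congrArg CuspLabels.cuspY h) 0
  exact Set.singleton_ne_empty _ h1.symm

end EtaleThetaData.DoubleUnderline

/-! ### At the root model `ThetaSetting.model p`: the parameter type is empty -/

/-- **No `X̲̲`-data over the root model**: since there is no étale theta datum
`E : (ThetaSetting.model p).EtaleThetaData` (abc-iut-w5-d171, `ThetaSetting.model_isEmpty_etaleThetaData`: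
Kummer data need a non-trivial cyclotomic action on `Δ_Θ`, which the discrete root model lacks), there
is no pair `(E, C : E.DoubleUnderline l)` at the root model — hence no `CuspLabels` type to inhabit there.
[cite: MochizukiEtTh2009, Def 2.5 p.39] -/
theorem isEmpty_sigma_doubleUnderline_model (p : ℕ) [Fact p.Prime] (l : ℕ) :
    IsEmpty ((E : (ThetaSetting.model p).EtaleThetaData) × E.DoubleUnderline l) :=
  ⟨fun x => (ThetaSetting.model_isEmpty_etaleThetaData p).false x.1⟩

/-- **Every statement about cusp labels at the root model holds vacuously** (NV-L2 census: the row
«CuspLabels at `ThetaSetting.model p`» is vacuous-by-emptiness of `EtaleThetaData`, BY NAME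
`ThetaSetting.model_isEmpty_etaleThetaData`; the informative statements are the parameter-generic
ones above). [cite: MochizukiEtTh2009, Cor 2.9 p.43] -/
theorem forall_cuspLabels_model (p : ℕ) [Fact p.Prime] (l : ℕ)
    (P : ∀ (E : (ThetaSetting.model p).EtaleThetaData) (C : E.DoubleUnderline l), C.CuspLabels → Prop) :
    ∀ (E : (ThetaSetting.model p).EtaleThetaData) (C : E.DoubleUnderline l) (L : C.CuspLabels), P E C L :=
  fun E => ((ThetaSetting.model_isEmpty_etaleThetaData p).false E).elim

end ThetaSetting

end Literature.AnabelianGeometry.EtaleTheta
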